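import Mathlib
import Summits.ValiantsHypothesis.ValiantsHypothesis.Theses.BarrierLever

/-!
# Route BarrierLever — conjecture CT (`TransversalResultantKernelNonsingular`, stmt-ValiantsHypothesis-19179):
# the TROPICAL CERTIFICATE — a unique optimal assignment forces a nonzero layout minor

**Setting (cell valiant-natproofs, rung V4, 𝒟-side; planner p1 gen 8, memo TNS-calculus-g8 §8
«CT ⇐ UT»).** A RESULTANT-TYPE matrix has entries
`M[i, j] = ∏_{a : α} ∏_{c : γ} (p (R i a) - q (S j c))` (`p : ι → ℂ`, `q : κ → ℂ`, index maps
`R : Fin r → α → ι`, `S : Fin r → γ → κ`); the CT layout matrices are the case `α = γ = Fin h`,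
`ι = κ = Fin (h + h)`, `R i = ρ_{u_i}` (row transversal), `S j = τ_{w_j}` (column transversal).

**Theorem (`det_resultantMatrix_ne_zero_of_unique_assignment`).** Fix a COHERENT DEGENERATION:
a map `μ : ι → Option κ` ("`p_i` collides with `q_{μ i}`") and weights `wt : ι → ℕ`. Put
`ord i j := Σ_{a,c} [μ (R i a) = some (S j c)] · wt (R i a)` and, for a bijection `σ` of `Fin r`,
`cost σ := Σ_j ord (σ j) j`. IF some `π₀` has `cost π₀ < cost σ` for every `σ ≠ π₀` (the assignment
problem has a UNIQUE optimum), THEN `det M ≠ 0` for some `p, q`.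
*Proof.* Over `ℂ[ε]` take `q_k := 2k + 2`, `p_i := (2·μ(i) + 2) + ε^{wt i}` (`p_i := ε^{wt i}` off the
domain; `k` encoded injectively in `ℕ`).
Every factor `p (R i a) - q (S j c)` is `ε^{wt}` when `μ (R i a) = some (S j c)` and otherwise a
polynomial with nonzero constant term, so `M[i, j] = ε^{ord i j} · G_{ij}`, `G_{ij}(0) ≠ 0`; in the
Leibniz expansion the coefficient of `ε^{cost π₀}` is `± ∏_j G_{π₀ j, j}(0) ≠ 0`. A nonzero polynomial
over `ℂ` has a non-root `ε₀`; evaluate.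

**Corollary (`resultantKernel_layout_ne_zero_of_unique_assignment`)** = the CT-shaped instance
(the «UT(U, W) ⇒ CT(U, W)» lemma of the memo): a unique-optimum certificate `(μ, wt, π₀)` for a
layout `(u, w)` yields `p, q ∈ ℂ^{h+h}` with
`det (∏_{a,c} (p (ρ_{u_i} a) - q (τ_{w_j} c)))_{i,j} ≠ 0` — so CT (stmt-19179), hence TT ⇒ TNS ⇒
`PartitionMinorsHitByVP` (items 19180, 19153, 19133), reduces to the purely combinatorial
unique-assignment statement UT, finitely checkable per layout (certificate = `μ, wt, π₀`).

No injectivity of `μ`, `u`, `w` and no positivity of `wt` is needed.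

WHAT THIS IS NOT: not a proof of CT/UT for all layouts (UT is OPEN; the memo's random search finds
partial-injection certificates for all layouts with h ≤ 4 and most sampled ones at h = 5); only the
partial-injection ("cherry forest") valuations, not general ultrametric trees or non-unique optima.

References: tropical/valuative leading terms of determinants (e.g. [Burgisser2000] §4 style
degeneration arguments); N. Nisan, STOC 1991; [ForbesShpilkaVolk2018] Question 6.
-/

-- layout Summits/ValiantsHypothesis/ValiantsHypothesis forces the duplicated namespace component
set_option linter.dupNamespace false

open Polynomial Finset

namespace Summit.ValiantsHypothesis.ValiantsHypothesis.Theorems.BarrierLever.ResultantKernel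

/-! ## 1. Polynomial bookkeeping -/

/-- A product of terms `X ^ e_k * g_k` is `X ^ (Σ e_k) * ∏ g_k`. -/
theorem prod_X_pow_mul {β : Type*} (s : Finset β) (e : β → ℕ) (g : β → ℂ[X]) :
    ∏ k ∈ s, (X ^ e k * g k) = X ^ (∑ k ∈ s, e k) * ∏ k ∈ s, g k := by
  rw [Finset.prod_mul_distrib, Finset.prod_pow_eq_pow_sum]

/-- A nonzero polynomial over `ℂ` has a non-root. -/
theorem exists_eval_ne_zero_of_ne_zero {f : ℂ[X]} (hf : f ≠ 0) : ∃ z : ℂ, f.eval z ≠ 0 := by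
  by_contra hcon
  push Not at hcon
  apply hf
  refine Polynomial.eq_zero_of_infinite_isRoot f ?_
  have hall : {x : ℂ | f.IsRoot x} = Set.univ := Set.eq_univ_of_forall fun x => hcon x
  rw [hall]
  exact Set.infinite_univ

/-! ## 2. The tropical certificate for resultant-type matrices -/

/-- **Unique optimal assignment ⇒ nonzero determinant** for resultant-type matrices
`M[i,j] = ∏_{a,c} (p (R i a) - q (S j c))`: if, for a degeneration pattern `μ : ι → Option κ` with
weights `wt`, the assignment problem `σ ↦ Σ_j ord (σ j) j` has a unique minimiser `π₀`, then
`det M ≠ 0` for some complex parameters `p, q`. -/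
theorem det_resultantMatrix_ne_zero_of_unique_assignment
    {ι κ α γ : Type*} [Fintype α] [Fintype γ] [DecidableEq κ] {r : ℕ}
    (R : Fin r → α → ι) (S : Fin r → γ → κ) (μ : ι → Option κ) (wt : ι → ℕ)
    (enc : κ → ℕ) (henc : Function.Injective enc)
    (ord : Fin r → Fin r → ℕ)
    (hord : ∀ i j, ord i j = ∑ a, ∑ c, if μ (R i a) = some (S j c) then wt (R i a) else 0)
    (π₀ : Equiv.Perm (Fin r))
    (huniq : ∀ σ : Equiv.Perm (Fin r), σ ≠ π₀ → ∑ j, ord (π₀ j) j < ∑ j, ord (σ j) j) :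
    ∃ p : ι → ℂ, ∃ q : κ → ℂ,
      (Matrix.of fun i j : Fin r => ∏ a, ∏ c, (p (R i a) - q (S j c))).det ≠ 0 := by
  classical
  -- the one-parameter family over ℂ[ε]: `q_k := 2·enc k + 2`, `p_i := cμ i + ε^{wt i}` with
  -- `cμ i = 2·enc k + 2` if `μ i = some k` and `cμ i = 0` otherwise
  set cμ : ι → ℕ := fun i => (μ i).elim 0 (fun k => 2 * enc k + 2) with hcμ
  set qP : κ → ℂ[X] := fun k => C ((2 * enc k + 2 : ℕ) : ℂ) with hqP
  set pP : ι → ℂ[X] := fun i => C ((cμ i : ℕ) : ℂ) + X ^ wt i with hpP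
  -- each factor: `ε^e · g` with `g(0) ≠ 0`
  set e : ι → κ → ℕ := fun i k => if μ i = some k then wt i else 0 with he
  set g : ι → κ → ℂ[X] := fun i k => if μ i = some k then 1 else pP i - qP k with hg
  have hfac : ∀ i k, pP i - qP k = X ^ e i k * g i k := by
    intro i k
    by_cases hik : μ i = some k
    · have hc : cμ i = 2 * enc k + 2 := by simp [hcμ, hik]
      simp only [he, hg, hik, if_true, hpP, hqP, hc, mul_one, add_sub_cancel_left]
    · simp only [he, hg, hik, if_false, pow_zero, one_mul]
  have hg0 : ∀ i k, (g i k).eval 0 ≠ 0 := by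
    intro i k
    by_cases hik : μ i = some k
    · simp [hg, hik]
    · simp only [hg, hik, if_false, hpP, hqP, eval_add, eval_sub, eval_C, eval_pow, eval_X]
      -- the constant term `cμ i + 0^{wt i} - (2 enc k + 2)` is nonzero (parity / injectivity)
      have hb : ∃ b : ℕ, b ≤ 1 ∧ ((0 : ℂ) ^ wt i) = (b : ℂ) := by
        rcases Nat.eq_zero_or_pos (wt i) with hw | hw
        · exact ⟨1, le_rfl, by rw [hw, pow_zero, Nat.cast_one]⟩
        · exact ⟨0, Nat.zero_le _, by rw [zero_pow (Nat.pos_iff_ne_zero.1 hw), Nat.cast_zero]⟩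
      obtain ⟨b, hb1, hbeq⟩ := hb
      rw [hbeq]
      intro h0
      have h1 : ((cμ i + b : ℕ) : ℂ) = ((2 * enc k + 2 : ℕ) : ℂ) := by
        push_cast at h0 ⊢
        linear_combination h0
      have h2 : cμ i + b = 2 * enc k + 2 := Nat.cast_injective h1
      rcases hμi : μ i with _ | k'
      · have hc : cμ i = 0 := by simp [hcμ, hμi]
        omega
      · have hc : cμ i = 2 * enc k' + 2 := by simp [hcμ, hμi]
        rw [hμi] at hik
        have hne : enc k' ≠ enc k := fun h' => hik (by rw [henc h'])
        omega
  -- the matrix over ℂ[ε] and its entries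
  set Mε : Matrix (Fin r) (Fin r) ℂ[X] :=
    Matrix.of fun i j => ∏ a, ∏ c, (pP (R i a) - qP (S j c)) with hMε
  set G : Fin r → Fin r → ℂ[X] := fun i j => ∏ a, ∏ c, g (R i a) (S j c) with hG
  have hentry : ∀ i j, Mε i j = X ^ ord i j * G i j := by
    intro i j
    rw [hMε, Matrix.of_apply, hord i j, hG]
    simp only
    simp_rw [hfac]
    simp_rw [prod_X_pow_mul]
    rfl
  have hG0 : ∀ i j, (G i j).eval 0 ≠ 0 := by
    intro i j
    rw [hG]
    simp only [eval_prod]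
    exact Finset.prod_ne_zero_iff.2 fun a _ => Finset.prod_ne_zero_iff.2 fun c _ => hg0 _ _
  -- the coefficient of ε^{cost π₀} in det Mε
  set m₀ : ℕ := ∑ j, ord (π₀ j) j with hm₀
  have hcoeff : Mε.det.coeff m₀ =
      ((Equiv.Perm.sign π₀ : ℤ) : ℂ) * ∏ j, (G (π₀ j) j).eval 0 := by
    rw [Matrix.det_apply', finsetSum_coeff]
    rw [Finset.sum_eq_single π₀]
    · rw [show (((Equiv.Perm.sign π₀ : ℤ)) : ℂ[X]) = C ((Equiv.Perm.sign π₀ : ℤ) : ℂ) from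
        (map_intCast (Polynomial.C : ℂ →+* ℂ[X]) _).symm, coeff_C_mul]
      congr 1
      simp_rw [hentry]
      rw [prod_X_pow_mul, coeff_X_pow_mul', if_pos (le_of_eq hm₀.symm), hm₀, Nat.sub_self,
        coeff_zero_eq_eval_zero, eval_prod]
    · intro σ _ hσ
      rw [show (((Equiv.Perm.sign σ : ℤ)) : ℂ[X]) = C ((Equiv.Perm.sign σ : ℤ) : ℂ) from
        (map_intCast (Polynomial.C : ℂ →+* ℂ[X]) _).symm, coeff_C_mul]
      simp_rw [hentry]
      rw [prod_X_pow_mul, coeff_X_pow_mul', if_neg (not_le.2 (huniq σ hσ)), mul_zero]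
    · intro h
      exact absurd (Finset.mem_univ π₀) h
  have hdet : Mε.det ≠ 0 := by
    intro hz
    have h1 := hcoeff
    rw [hz, coeff_zero] at h1
    refine mul_ne_zero ?_ (Finset.prod_ne_zero_iff.2 fun j _ => hG0 _ _) h1.symm
    exact Int.cast_ne_zero.2 (Units.ne_zero _)
  -- evaluate at a non-root
  obtain ⟨z, hz⟩ := exists_eval_ne_zero_of_ne_zero hdet
  refine ⟨fun i => (pP i).eval z, fun k => (qP k).eval z, ?_⟩
  have heval : (Matrix.of fun i j : Fin r => ∏ a, ∏ c, ((pP (R i a)).eval z - (qP (S j c)).eval z)).det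
      = Mε.det.eval z := by
    rw [hMε, ← Polynomial.coe_evalRingHom, RingHom.map_det]
    congr 1
    ext i j
    simp only [RingHom.mapMatrix_apply, Matrix.map_apply, Matrix.of_apply,
      Polynomial.coe_evalRingHom, eval_prod, eval_sub]
  rw [heval]
  exact hz

/-! ## 3. The CT-shaped corollary: UT(U, W) ⇒ CT(U, W) -/

/-- **UT ⇒ CT for one layout** (memo TNS-calculus-g8 §8): a unique-optimum certificate
`(μ, wt, π₀)` for the transversal layout `(u, w)` — with
`ord i j = Σ_{a,c} [μ (ρ_{u_i} a) = some (τ_{w_j} c)] · wt (ρ_{u_i} a)` — gives parameters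
`p, q ∈ ℂ^{h+h}` at which the CT layout minor `det (∏_{a,c} (p (ρ_{u_i} a) - q (τ_{w_j} c)))` is
nonzero. -/
theorem resultantKernel_layout_ne_zero_of_unique_assignment
    (h r : ℕ) (u w : Fin r → Finset (Fin h))
    (μ : Fin (h + h) → Option (Fin (h + h))) (wt : Fin (h + h) → ℕ)
    (ord : Fin r → Fin r → ℕ)
    (hord : ∀ i j, ord i j = ∑ a : Fin h, ∑ c : Fin h,
      if μ (if a ∈ u i then Fin.castAdd h a else Fin.natAdd h a)
          = some (if c ∈ w j then Fin.natAdd h c else Fin.castAdd h c)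
      then wt (if a ∈ u i then Fin.castAdd h a else Fin.natAdd h a) else 0)
    (π₀ : Equiv.Perm (Fin r))
    (huniq : ∀ σ : Equiv.Perm (Fin r), σ ≠ π₀ → ∑ j, ord (π₀ j) j < ∑ j, ord (σ j) j) :
    ∃ p q : Fin (h + h) → ℂ, (Matrix.of fun i j : Fin r => ∏ a : Fin h, ∏ c : Fin h,
      (p (if a ∈ u i then Fin.castAdd h a else Fin.natAdd h a)
        - q (if c ∈ w j then Fin.natAdd h c else Fin.castAdd h c))).det ≠ 0 :=
  det_resultantMatrix_ne_zero_of_unique_assignment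
    (fun i a => if a ∈ u i then Fin.castAdd h a else Fin.natAdd h a)
    (fun j c => if c ∈ w j then Fin.natAdd h c else Fin.castAdd h c)
    μ wt Fin.val Fin.val_injective ord hord π₀ huniq

end Summit.ValiantsHypothesis.ValiantsHypothesis.Theorems.BarrierLever.ResultantKernel
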